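import Literature.NumberTheory.FaltingsSerre.ResidualRigidityS3wrS2
import Literature.NumberTheory.FaltingsSerre.ConjCertificateRoutes
import HarnessLib

/-!
# Subgroups of order `72` of `S₆` are the conjugates of `S₃ ≀ S₂`

[BPPTVY] = Brumer–Pacetti–Poor–Tornaría–Voight–Yuen, *On the paramodularity of typical abelian
surfaces*, Algebra & Number Theory 13:5 (2019).  In the case `N = 353` [BPPTVY, Thm 7.2.1,
pp. 1189–1190] the residual image is "`S₃ ≀ C₂`" — the Galois group of the `2`-division field, of
order `72`.  The tree's rigidity theorem for this image type
(`exists_conj_of_ker_iff_of_range_S3wrS2`, `ConjCertificate.ofRangeS3wrS2`) takes as hypothesis that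
the residual image is a CONJUGATE OF THE STANDARD `S₃ ≀ S₂ = ⟨(1 2 3), (1 2), (1 4)(2 5)(3 6)⟩ ≤ S₆`
under `ι : S₆ ≅ Sp₄(𝔽₂)`.  This file proves the purely group-theoretic fact that makes the COUNT
`#im ρ̄ = 72` (what a certificate producer knows: the order of the Galois group of the `2`-division
field) sufficient:

* `Perm6.exists_eq_conj_closure_gensS3wrS2_of_card` — every subgroup of `S₆` of order `72` is a
  conjugate of `S₃ ≀ S₂`;
* `GSp4F2.exists_range_eq_conj_S3wrS2_of_card` — hence a subgroup of `ι(S₆)` of order `72` is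
  `ι(g (S₃ ≀ S₂) g⁻¹)`, in the exact shape of the hypothesis `h₁` of
  `exists_conj_of_ker_iff_of_range_S3wrS2`; `GSp4F2.residual_range_S3wrS2_of_card` — the same for
  a `GSp(J)`-valued framed `2`-adic representation;
* `ConjCertificate.ofCardS3wrS2` — the `S₃ ≀ S₂` constructor of the pair certificate with the range
  hypothesis replaced by the count `72` (companion of `ConjCertificate.ofCard720`-style `S₆`
  constructor `GSp4F2.residual_range_eq_iotaGL_of_card`).

Proof (folklore; Sylow): a subgroup `H ≤ S₆` of order `72` contains a subgroup of order `9`, which is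
a Sylow `3`-subgroup of `S₆`, hence conjugate to `P₀ = ⟨(1 2 3), (4 5 6)⟩`; so a conjugate `H'` of `H`
contains `P₀`.  KERNEL CHECKS (`decide`): for every `h ∈ S₆` NOT preserving the partition
`{1,2,3} ⊔ {4,5,6}`, one of the `3`-cycles `h (1 2 3) h⁻¹`, `h (4 5 6) h⁻¹ ∈ H'` has support meeting
`{1,2,3}` in exactly one point, and the product of `(1 2 3)` with such a `3`-cycle has order `5` (a
`5`-cycle).  So if some `h ∈ H'` did not preserve the partition, `H'` would contain an element of
order `5 ∤ 72`; hence `H' ≤ S₃ ≀ S₂` (`mem_closure_gensS3wrS2_iff_blocks`), and both have order `72`.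
-/

noncomputable section

namespace Literature.NumberTheory.FaltingsSerre

open Matrix Equiv Equiv.Perm Field IsDedekindDomain
open Literature.NumberTheory.GaloisRepresentations Literature.NumberTheory.FaltingsSerre.GSp4F2
open scoped NumberField Pointwise

/-! ### A. The standard Sylow `3`-subgroup `P₀ = ⟨(1 2 3), (4 5 6)⟩` of `S₆` -/

namespace Perm6

/-- `(4 5 6) ∈ S₆`. [folklore] -/
def c456 : Perm (Fin 6) := c[(3 : Fin 6), 4, 5]

/-- The nine elements of `P₀ = ⟨(1 2 3), (4 5 6)⟩`. [folklore] -/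
def sylow3StdList : List (Perm (Fin 6)) :=
  [1, c123, c123 ^ 2, c456, c456 ^ 2, c123 * c456, c123 * c456 ^ 2, c123 ^ 2 * c456,
    c123 ^ 2 * c456 ^ 2]

/-- KERNEL CHECK: the list is closed under products and inverses and contains `1`. [folklore] -/
theorem sylow3StdList_closed :
    (1 : Perm (Fin 6)) ∈ sylow3StdList ∧
    (∀ a ∈ sylow3StdList, ∀ b ∈ sylow3StdList, a * b ∈ sylow3StdList) ∧
    (∀ a ∈ sylow3StdList, a⁻¹ ∈ sylow3StdList) := by
  unfold sylow3StdList c123 c456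
  refine ⟨?_, ?_, ?_⟩ <;> decide +kernel

/-- `P₀ = ⟨(1 2 3), (4 5 6)⟩ ≤ S₆` as a subgroup with decidable membership. [folklore] -/
def sylow3Std : Subgroup (Perm (Fin 6)) where
  carrier := {g | g ∈ sylow3StdList}
  mul_mem' := fun {a} {b} ha hb => sylow3StdList_closed.2.1 a ha b hb
  one_mem' := sylow3StdList_closed.1
  inv_mem' := fun {a} ha => sylow3StdList_closed.2.2 a ha

/-- Membership in `P₀` is membership in the list. [folklore] -/
theorem mem_sylow3Std_iff (g : Perm (Fin 6)) : g ∈ sylow3Std ↔ g ∈ sylow3StdList := Iff.rfl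

/-- Membership in `P₀` is decidable. [folklore] -/
instance : DecidablePred (· ∈ sylow3Std) := fun g =>
  inferInstanceAs (Decidable (g ∈ sylow3StdList))

/-- KERNEL CHECK: `#P₀ = 9`. [folklore] -/
theorem card_sylow3Std : Nat.card sylow3Std = 9 := by
  rw [Nat.card_eq_fintype_card, Fintype.card_subtype]
  unfold sylow3Std sylow3StdList c123 c456
  decide +kernel

/-- `#S₆ = 720` and the `3`-part of `720` is `9`. [folklore] -/
theorem card_perm6_factorization_three : (Nat.card (Perm (Fin 6))).factorization 3 = 2 := by
  have h : Nat.card (Perm (Fin 6)) = 3 ^ 2 * 80 := by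
    rw [Nat.card_perm, Nat.card_eq_fintype_card, Fintype.card_fin]; rfl
  rw [h, Nat.factorization_mul (by norm_num) (by norm_num), Finsupp.add_apply,
    Nat.Prime.factorization_pow Nat.prime_three, Finsupp.single_eq_same,
    Nat.factorization_eq_zero_of_not_dvd (by norm_num)]

/-! ### B. Block preservation and the order-`5` obstruction -/

/-- `g` preserves the partition `{1,2,3} ⊔ {4,5,6}` (maps the first block into a block). [folklore] -/
def PreservesBlocks (g : Perm (Fin 6)) : Prop :=
  (∀ i : Fin 6, (i : ℕ) < 3 → ((g i : Fin 6) : ℕ) < 3) ∨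
    (∀ i : Fin 6, (i : ℕ) < 3 → 3 ≤ ((g i : Fin 6) : ℕ))

/-- Block preservation is decidable. [folklore] -/
instance : DecidablePred PreservesBlocks := fun g => by
  unfold PreservesBlocks; infer_instance

/-- `S₃ ≀ S₂ = {g | g` preserves the blocks`}` (the tree's word enumeration). [cite: BrumerEtAl2019, Lemma 5.1.7 p. 1174] -/
theorem mem_closure_gensS3wrS2_iff_preservesBlocks (g : Perm (Fin 6)) :
    g ∈ Subgroup.closure (Set.range gensS3wrS2) ↔ PreservesBlocks g :=
  mem_closure_gensS3wrS2_iff_blocks g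

set_option maxRecDepth 20000 in
/-- KERNEL CHECK: exactly `72` permutations preserve the blocks. [folklore] -/
theorem card_filter_preservesBlocks :
    (Finset.univ.filter fun g : Perm (Fin 6) => PreservesBlocks g).card = 72 := by
  decide +kernel

/-- `#(S₃ ≀ S₂) = 72`. [cite: BrumerEtAl2019, §7.2 p. 1189] -/
theorem card_closure_gensS3wrS2 :
    Nat.card (Subgroup.closure (Set.range gensS3wrS2) : Subgroup (Perm (Fin 6))) = 72 := by
  have e : ↥(Subgroup.closure (Set.range gensS3wrS2) : Subgroup (Perm (Fin 6))) ≃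
      {g : Perm (Fin 6) // PreservesBlocks g} :=
    Equiv.subtypeEquivRight mem_closure_gensS3wrS2_iff_preservesBlocks
  rw [Nat.card_congr e, Nat.card_eq_fintype_card, Fintype.card_subtype]
  exact card_filter_preservesBlocks

/-- `y` moves exactly one of the letters `1, 2, 3` (for a `3`-cycle: its support meets the block
`{1,2,3}` in one point). [folklore] -/
def MeetsOnce (y : Perm (Fin 6)) : Prop :=
  (y 0 ≠ 0 ∧ y 1 = 1 ∧ y 2 = 2) ∨ (y 0 = 0 ∧ y 1 ≠ 1 ∧ y 2 = 2) ∨ (y 0 = 0 ∧ y 1 = 1 ∧ y 2 ≠ 2)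

/-- `MeetsOnce` is decidable. [folklore] -/
instance : DecidablePred MeetsOnce := fun g => by
  unfold MeetsOnce; infer_instance

set_option maxHeartbeats 1000000 in
set_option maxRecDepth 20000 in
/-- KERNEL CHECK: if `h` does NOT preserve the blocks, then one of the `3`-cycles `h (1 2 3) h⁻¹`,
`h (4 5 6) h⁻¹` (supports `h{1,2,3}`, `h{4,5,6}`) has support meeting `{1,2,3}` in exactly one
point. [folklore] -/
theorem preservesBlocks_or_meetsOnce : ∀ h : Perm (Fin 6),
    PreservesBlocks h ∨ MeetsOnce (h * c123 * h⁻¹) ∨ MeetsOnce (h * c456 * h⁻¹) := by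
  unfold PreservesBlocks MeetsOnce c123 c456
  decide +kernel

set_option maxHeartbeats 1000000 in
set_option maxRecDepth 20000 in
/-- KERNEL CHECK (the obstruction): an element of order dividing `3` moving exactly one letter of
`{1,2,3}` is a `3`-cycle meeting `(1 2 3)` in one point, and the product `(1 2 3) · y` has order `5`
(a `5`-cycle). [folklore] -/
theorem orderFive_of_meetsOnce : ∀ y : Perm (Fin 6), y ^ 3 = 1 → MeetsOnce y →
    (c123 * y) ^ 5 = 1 ∧ c123 * y ≠ 1 := by
  unfold MeetsOnce c123
  decide +kernel

/-- `(1 2 3)`, `(4 5 6) ∈ P₀`, both of order `3`. [folklore] -/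
theorem c123_c456_mem_sylow3Std :
    c123 ∈ sylow3Std ∧ c456 ∈ sylow3Std ∧ c123 ^ 3 = 1 ∧ c456 ^ 3 = 1 := by
  refine ⟨?_, ?_, ?_, ?_⟩
  · rw [mem_sylow3Std_iff, sylow3StdList]; simp
  · rw [mem_sylow3Std_iff, sylow3StdList]; simp
  · unfold c123; decide +kernel
  · unfold c456; decide +kernel

/-! ### C. Every subgroup of order `72` is a conjugate of `S₃ ≀ S₂` -/

/-- A subgroup of `S₆` of order `72` containing `P₀` IS `S₃ ≀ S₂`. [folklore] -/
theorem eq_closure_gensS3wrS2_of_card_of_sylow3Std_le (H : Subgroup (Perm (Fin 6)))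
    (hH : Nat.card H = 72) (hP : sylow3Std ≤ H) :
    H = Subgroup.closure (Set.range gensS3wrS2) := by
  classical
  apply Subgroup.eq_of_le_of_card_ge
  · intro h hh
    rw [mem_closure_gensS3wrS2_iff_preservesBlocks]
    obtain ⟨h123, h456, h3, h3'⟩ := c123_c456_mem_sylow3Std
    -- an element `y ∈ H` of order dividing 3 moving exactly one letter of the first block is absurd
    have key : ∀ y ∈ H, y ^ 3 = 1 → ¬ MeetsOnce y := by
      intro y hy hy3 hm
      obtain ⟨h5, h1⟩ := orderFive_of_meetsOnce y hy3 hm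
      have hz : c123 * y ∈ H := H.mul_mem (hP h123) hy
      haveI : Fact (Nat.Prime 5) := ⟨by norm_num⟩
      have ho : orderOf (⟨c123 * y, hz⟩ : H) = 5 := by
        rw [← Subgroup.orderOf_coe]
        exact orderOf_eq_prime h5 h1
      have hdvd : 5 ∣ Nat.card H := ho ▸ orderOf_dvd_natCard _
      rw [hH] at hdvd
      exact absurd hdvd (by norm_num)
    rcases preservesBlocks_or_meetsOnce h with hb | hm | hm
    · exact hb
    · exact absurd hm (key _ (H.mul_mem (H.mul_mem hh (hP h123)) (H.inv_mem hh))
        (by rw [conj_pow, h3, mul_one, mul_inv_cancel]))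
    · exact absurd hm (key _ (H.mul_mem (H.mul_mem hh (hP h456)) (H.inv_mem hh))
        (by rw [conj_pow, h3', mul_one, mul_inv_cancel]))
  · rw [card_closure_gensS3wrS2, hH]

/-- **Every subgroup of `S₆` of order `72` is a conjugate of `S₃ ≀ S₂`** (so "Galois group
`S₃ ≀ C₂`" in [BPPTVY, §7.2] may be read as "of order `72`"). [cite: BrumerEtAl2019, §7.2 pp. 1189–1190] -/
theorem exists_eq_conj_closure_gensS3wrS2_of_card (H : Subgroup (Perm (Fin 6)))
    (hH : Nat.card H = 72) :
    ∃ g : Perm (Fin 6),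
      H = (Subgroup.closure (Set.range gensS3wrS2)).map (MulAut.conj g).toMonoidHom := by
  classical
  haveI : Fact (Nat.Prime 3) := ⟨Nat.prime_three⟩
  -- an order-9 subgroup of `H`
  obtain ⟨K, hK⟩ := Sylow.exists_subgroup_card_pow_prime (G := H) 3 (n := 2)
    (by rw [hH]; norm_num)
  set Q : Subgroup (Perm (Fin 6)) := K.map H.subtype with hQdef
  have hQH : Q ≤ H := Subgroup.map_subtype_le K
  have hQ : Nat.card Q = 9 := by
    rw [hQdef, Subgroup.card_map_of_injective H.subtype_injective, hK]; norm_num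
  -- it is a Sylow 3-subgroup of `S₆`, hence conjugate to `P₀`
  let SQ : Sylow 3 (Perm (Fin 6)) :=
    Sylow.ofCard Q (by rw [hQ, card_perm6_factorization_three]; norm_num)
  let S0 : Sylow 3 (Perm (Fin 6)) :=
    Sylow.ofCard sylow3Std (by rw [card_sylow3Std, card_perm6_factorization_three]; norm_num)
  obtain ⟨g, hg⟩ := MulAction.exists_smul_eq (Perm (Fin 6)) SQ S0
  have hgQ : MulAut.conj g • Q = sylow3Std := by
    have h := congrArg (fun S : Sylow 3 (Perm (Fin 6)) => (S : Subgroup (Perm (Fin 6)))) hg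
    simpa only [Sylow.coe_subgroup_smul, SQ, S0, Sylow.coe_ofCard] using h
  -- the conjugate `H' = g H g⁻¹` contains `P₀` and has order 72, so it is `S₃ ≀ S₂`
  set H' : Subgroup (Perm (Fin 6)) := MulAut.conj g • H with hH'def
  have hP : sylow3Std ≤ H' := by
    rw [← hgQ, hH'def]
    exact Subgroup.pointwise_smul_le_pointwise_smul_iff.2 hQH
  have hH' : Nat.card H' = 72 := by
    rw [hH'def, ← Nat.card_congr (Subgroup.equivSMul (MulAut.conj g) H).toEquiv, hH]
  have hEq := eq_closure_gensS3wrS2_of_card_of_sylow3Std_le H' hH' hP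
  refine ⟨g⁻¹, ?_⟩
  have : H = MulAut.conj g⁻¹ • H' := by
    rw [hH'def, smul_smul, ← map_mul, inv_mul_cancel, map_one, one_smul]
  rw [this, hEq]
  rfl

end Perm6

/-! ### D. The `Sp₄(𝔽₂)`-side statements -/

/-- **Image `S₃ ≀ S₂` from a count**: a subgroup of `ι(S₆)` of order `72` is `ι` of a conjugate of
the standard `S₃ ≀ S₂` — the hypothesis `h₁` of `exists_conj_of_ker_iff_of_range_S3wrS2`. [cite: BrumerEtAl2019, §7.2 pp. 1189–1190] -/
theorem GSp4F2.exists_range_eq_conj_S3wrS2_of_card {Γ : Type*} [Group Γ]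
    (σ : Γ →* GL (Fin 4) (ZMod 2)) (hSp : σ.range ≤ iotaGL.range) (h : Nat.card σ.range = 72) :
    ∃ g₁ : Perm (Fin 6), σ.range =
      ((Subgroup.closure (Set.range gensS3wrS2)).map (MulAut.conj g₁).toMonoidHom).map iotaGL := by
  set H : Subgroup (Perm (Fin 6)) := σ.range.comap iotaGL with hHdef
  have hHσ : H.map iotaGL = σ.range := Subgroup.map_comap_eq_self hSp
  have hH : Nat.card H = 72 := by
    rw [← h, ← hHσ, Subgroup.card_map_of_injective iotaGL_injective]
  obtain ⟨g, hg⟩ := Perm6.exists_eq_conj_closure_gensS3wrS2_of_card H hH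
  exact ⟨g, by rw [← hHσ, hg]⟩

section Residual

variable {G : Type*} [Group G] [TopologicalSpace G] (ρ₁ : FramedRep G ℤ_[2] 4) (ν₁ : G → ℤ_[2])

/-- The same for the residual representation of a `GSp(J)`-valued framed representation, the
symplectic hypothesis being discharged from the similitude data. [cite: BrumerEtAl2019, §2.1 p. 1150 and §7.2 p. 1189] -/
theorem GSp4F2.residual_range_S3wrS2_of_card
    (hs₁ : ∀ σ, IsSimilitude (antiIdAlt4 ℤ_[2]) (ν₁ σ)
      ((ρ₁ σ : GL (Fin 4) ℤ_[2]) : Matrix (Fin 4) (Fin 4) ℤ_[2]))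
    (h : Nat.card (residual ρ₁.toMonoidHom).range = 72) :
    ∃ g₁ : Perm (Fin 6), (residual ρ₁.toMonoidHom).range =
      ((Subgroup.closure (Set.range gensS3wrS2)).map (MulAut.conj g₁).toMonoidHom).map iotaGL :=
  GSp4F2.exists_range_eq_conj_S3wrS2_of_card _ (range_residual_le_iotaGL_framed ρ₁ ν₁ hs₁) h

end Residual

section Constructor

variable {K : Type} [Field K] {S P : Set (HeightOneSpectrum (𝓞 K))}
  {ν : absoluteGaloisGroup K → ℤ_[2]} {ρ₁ ρ₂ : FramedGaloisRep K ℤ_[2] 4}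

/-- **Image-`S₃ ≀ S₂` constructor of the pair certificate, from the count `#im ρ̄₁ = 72`** (the
other data exactly as in `ConjCertificate.ofRangeS3wrS2`: common kernel, an element `u` with
`ρ̄₁(u)` of order `3` or `6` and equal traces on both sides). [cite: BrumerEtAl2019, Thm 7.2.1 pp. 1189–1190] -/
theorem ConjCertificate.ofCardS3wrS2 (R : ConjCertificate.Rest S P ν ρ₁ ρ₂)
    (h72 : Nat.card (residual ρ₁.toMonoidHom).range = 72)
    (hker : ∀ γ, residual ρ₁.toMonoidHom γ = 1 ↔ residual ρ₂.toMonoidHom γ = 1)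
    {u : absoluteGaloisGroup K} (hu6 : residual ρ₁.toMonoidHom u ^ 6 = 1)
    (hu2 : residual ρ₁.toMonoidHom u ^ 2 ≠ 1)
    (htr : Matrix.trace ((residual ρ₁.toMonoidHom u : GL (Fin 4) (ZMod 2)) : Matrix (Fin 4) (Fin 4) (ZMod 2)) =
      Matrix.trace ((residual ρ₂.toMonoidHom u : GL (Fin 4) (ZMod 2)) : Matrix (Fin 4) (Fin 4) (ZMod 2))) :
    ConjCertificate S P ν ρ₁ ρ₂ :=
  ConjCertificate.ofRangeS3wrS2 R
    (GSp4F2.residual_range_S3wrS2_of_card ρ₁ ν R.similitude₁ h72) hker hu6 hu2 htr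

end Constructor

end Literature.NumberTheory.FaltingsSerre

end
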